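import Mathlib

/-!
# T5InvariantsImage — «the K-invariants of the image are the image of the K-invariants»
(T4-B3 §B7(b) / N1 §ID-2(c))

Prose step (route/T4-B3-p2.md B7(b), used again in route/T5-ID-p2.md ID-2(c)): Liu's Thm. 4.18(1)
gives the `G(𝔸_f)`-equivariant surjection `Hom_E(A_∞, A_μ)_ℚ ⊗ α ↠ ⊕_{ε,χ} H¹[ω(μ, ε, χ)]`, and
«the `K`-invariants of the image are the image of the `K`-invariants» — so the `K`-invariant
isotypic classes are the pull-backs `φ^*α` with `φ ∈ Hom_E(A_K, A_μ)_ℚ` (`= Hom_E(A_∞, A_μ)_ℚ^K`).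
The mechanism is the averaging projector `e_K` (a compact group; the level-`K` vectors are fixed by
`K` and the action factors through a finite quotient on any smooth vector).

Formalised for a FINITE group `G` and representations `ρ` on `V`, `σ` on `W` over a commutative
ring `k` in which `|G|` is invertible, with Mathlib's `Representation.averageMap`
(`= ⅟|G| · Σ_g ρ g`, a projector onto `ρ.invariants`): for a `G`-equivariant linear map
`f : V → W`, `range f ⊓ σ.invariants = (ρ.invariants).map f`; if `f` is surjective,
`σ.invariants = (ρ.invariants).map f`. (The abstract projector step was already kernel-checked as
`T5LiftProjector.LinearMap.exists_eq_map_of_fixed`; this file supplies the projector itself.)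
-/

namespace Summit.Ventures.HodgeRepro2.T5InvariantsImage

open Representation

variable {k G V W : Type*} [CommRing k] [Group G] [Fintype G] [Invertible (Fintype.card G : k)]
  [AddCommGroup V] [Module k V] [AddCommGroup W] [Module k W]
  (ρ : Representation k G V) (σ : Representation k G W)

/-- Mathlib's averaging projector, unfolded: `averageMap ρ v = ⅟|G| • Σ_g ρ g v`. -/
theorem averageMap_apply (v : V) :
    averageMap ρ v = ⅟(Fintype.card G : k) • ∑ g : G, ρ g v := by
  simp [averageMap, GroupAlgebra.average, map_sum, LinearMap.sum_apply]

variable {ρ σ}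

/-- A `G`-equivariant linear map commutes with the averaging projectors. -/
theorem map_averageMap (f : V →ₗ[k] W) (hf : ∀ g v, f (ρ g v) = σ g (f v)) (v : V) :
    f (averageMap ρ v) = averageMap σ (f v) := by
  rw [averageMap_apply, averageMap_apply, map_smul, map_sum]
  simp only [hf]

omit [Fintype G] [Invertible (Fintype.card G : k)] in
/-- An equivariant map sends invariants to invariants. -/
theorem map_mem_invariants (f : V →ₗ[k] W) (hf : ∀ g v, f (ρ g v) = σ g (f v)) {v : V}
    (hv : v ∈ ρ.invariants) : f v ∈ σ.invariants := by
  rw [mem_invariants] at hv ⊢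
  intro g
  rw [← hf, hv g]

/-- B7(b): for a `G`-equivariant linear map `f`, the invariants of the image are the image of
the invariants: `range f ⊓ σ.invariants = (ρ.invariants).map f`. -/
theorem range_inf_invariants_eq_map (f : V →ₗ[k] W) (hf : ∀ g v, f (ρ g v) = σ g (f v)) :
    LinearMap.range f ⊓ σ.invariants = (ρ.invariants).map f := by
  ext w
  constructor
  · rintro ⟨⟨v, rfl⟩, hw⟩
    refine ⟨averageMap ρ v, averageMap_invariant ρ v, ?_⟩
    rw [map_averageMap f hf, averageMap_id σ (f v) hw]
  · rintro ⟨v, hv, rfl⟩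
    exact ⟨⟨v, rfl⟩, map_mem_invariants f hf hv⟩

/-- B7(b) for a surjective equivariant map: every invariant of `W` is the image of an invariant
of `V` (the `K`-invariant isotypic classes are pull-backs of `K`-invariant homomorphisms). -/
theorem invariants_eq_map_of_surjective (f : V →ₗ[k] W) (hf : ∀ g v, f (ρ g v) = σ g (f v))
    (hs : Function.Surjective f) : σ.invariants = (ρ.invariants).map f := by
  rw [← range_inf_invariants_eq_map f hf, LinearMap.range_eq_top.mpr hs, top_inf_eq]

/-- The same, element-wise: an invariant `w` in the range of `f` is `f` of an invariant. -/
theorem exists_invariant_preimage (f : V →ₗ[k] W) (hf : ∀ g v, f (ρ g v) = σ g (f v)) {w : W}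
    (hw : w ∈ σ.invariants) (hr : w ∈ LinearMap.range f) :
    ∃ v ∈ ρ.invariants, f v = w := by
  have h : w ∈ (ρ.invariants).map f := by
    rw [← range_inf_invariants_eq_map f hf]
    exact ⟨hr, hw⟩
  obtain ⟨v, hv, rfl⟩ := h
  exact ⟨v, hv, rfl⟩

end Summit.Ventures.HodgeRepro2.T5InvariantsImage
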